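import Literature.NumberTheory.DiophantineGeometry.SUnitMordellHeightBoundsModularity
import Mathlib.Algebra.CubicDiscriminant
import HarnessLib

/-!
# Primitive solutions of Mordell equations, the difference of squares and cubes, cubic Thue and
# Thue–Mahler equations, generalized Ramanujan–Nagell equations: explicit height bounds via modularity
# (von Känel–Matschke 2016/2023, §1.2 Theorems G–L and §§7–9)

Topic `Literature/NumberTheory/DiophantineGeometry` (family `abc`; the *modular method*). Sequel to
`SUnitMordellHeightBoundsModularity.lean` (same setting: `S`, `N_S = primesProd S`, `𝒪 = ℤ[1/N_S]` =
`IsSInteger S`, `𝒪^× = IsSUnit S`, `h = Height.logHeight₁` on `ℚ`, `a_S = mordellLevel S a`,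
`Ω_sim = omegaSim`). Source: R. von Känel, B. Matschke, arXiv:1605.06079 (Feb. 2016 version, held TeX text) =
Mem. AMS **286** (2023) no. 1419 [`VonkanelMatschke2023`]; ALL LOCATORS ARE THE arXiv NUMBERING:
§1.2.1 Theorem G, Corollary H, Corollary I; §1.2.2 Corollary J; §1.2.3 Corollary K, condition `(*)`,
Corollary L (`corollary_L`; the first rendering `corollaryL` is RETIRED — refuted, see `not_corollaryL`); §7
Definition 7.1 (`def:ap`), Theorem 7.2 (`thm:m`), Corollary 7.3 (`cor:coates1`), Corollary
7.4 (`cor:coates2`); §9 Corollary 9.1 (`cor:ranabounds`), Corollary 9.3 (`cor:sumsofunits`). All are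
THEOREMS in print (proved from the height bounds of §10 via Shimura–Taniyama + Faltings' method; "an
alternative proof of classical theorems of Baker, Coates and Vinogradov–Sprindžuk").

## Rendering notes

* "primitive" `(x, y) ∈ ℤ × ℤ` (§1.2.1, after Bombieri–Gubler): `±1` are the only `n ∈ ℤ` with
  `n⁶ ∣ gcd(x³, y²)` — `IsPrimitivePair`.
* Definition 7.1 (`u_{x,y} = u₁/u₂`, "almost primitive with respect to `μ`"): `uOne`, `uTwo`, `uRatio`,
  `IsAlmostPrimitive` (the function `μ : ℤ_{≥1} → ℝ_{≥0}` is a `μ : ℕ → ℝ` evaluated at `a_S`).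
* `a_* = a_∅` (Theorem 7.2 (ii)) is `mordellLevel ∅ a`; `α_S = a_S / N_S = 1728 N_S r₂(a)` (§7.1) is
  `alphaLevel`; Coates' `f` = the largest divisor of `a` composed of primes in `S`, so `|a/f|` =
  `|a| / sPart S a`.
* The greatest rational prime divisor of `n` is `n.natAbs.primeFactors.sup id` (`0` when `|n| ≤ 1`; in
  Corollary 7.4 / I this only enlarges the printed scope harmlessly, see the docstrings).
* A cubic form `f ∈ 𝒪[x, y]` "homogeneous of degree 3 with nonzero discriminant" is a Mathlib `Cubic ℚ`
  `⟨a, b, c, d⟩` read as `f(x, y) = a x³ + b x² y + c x y² + d y³` (`cubicFormEval`) with `Cubic.discr ≠ 0`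
  (`= b²c² − 4ac³ − 4b³d − 27a²d² + 18abcd`, the discriminant `Δ` of the binary cubic form) and coefficients
  in `𝒪`; `h(f − m)` = the maximum of the heights of the coefficients of the polynomial `f − m`
  (`coeffHeight`).
* `Ω_opt` (Prop. 10.7, built from `α = min(β, β*)` of `Literature.NumberTheory.EllipticCurves.ModularForms.vkmAlpha`)
  is NOT used here: Corollaries 9.1 and 9.3 are recorded with `Ω_sim` in place of `Ω_opt`, which is WEAKER
  than print and implied by it through the printed inequality `Ω_opt ≤ Ω_sim` (§8.2, §9); Corollary 8.2
  (`cor:precthue`), (8.x) `eq:precthue` and Proposition 8.1 (`prop:heightineq`, the height comparison along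
  the covariant map `φ : X → Y`) are NOT typed.

No `abc` claim; typed ≠ proved; nothing here is discharged (named facts `def … : Prop`, D-0014), except the
unfolding/API lemmas.
-/

noncomputable section

open Height

namespace Literature.NumberTheory.DiophantineGeometry

namespace VonKanelMatschke

/-! ### Primitive and almost primitive solutions (§1.2.1; Definition 7.1) -/

/-- `(x, y) ∈ ℤ × ℤ` is **primitive** if `±1` are the only `n ∈ ℤ` with `n⁶ ∣ gcd(x³, y²)` (§1.2.1,
following Bombieri–Gubler; in particular coprime `x, y` are primitive).
[cite: VonkanelMatschke2023, §1.2.1 (definition of primitive)] -/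
def IsPrimitivePair (x y : ℤ) : Prop :=
  ∀ n : ℤ, n ^ 6 ∣ x ^ 3 → n ^ 6 ∣ y ^ 2 → n = 1 ∨ n = -1

/-- `u₁ ∈ ℤ_{≥1}` minimal with `u₁ x, u₁ y ∈ ℤ` (Definition 7.1), i.e. the lcm of the denominators.
[cite: VonkanelMatschke2023, Def. 7.1 (def:ap)] -/
def uOne (x y : ℚ) : ℕ := Nat.lcm x.den y.den

/-- `u₂ ∈ ℤ` maximal with `u₂⁶ ∣ gcd((u₁²x)³, (u₁³y)²)` (Definition 7.1; `u₁²x, u₁³y ∈ ℤ` are read off as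
numerators of integral rationals). Junk value `0` only when `x = y = 0`. [cite: VonkanelMatschke2023, Def. 7.1 (def:ap)] -/
def uTwo (x y : ℚ) : ℕ :=
  Nat.findGreatest
    (fun n => n ^ 6 ∣ Int.gcd ((((uOne x y : ℚ) ^ 2 * x).num) ^ 3) ((((uOne x y : ℚ) ^ 3 * y).num) ^ 2))
    (Int.gcd ((((uOne x y : ℚ) ^ 2 * x).num) ^ 3) ((((uOne x y : ℚ) ^ 3 * y).num) ^ 2))

/-- `u = u_{x,y} = u₁/u₂` of Definition 7.1 (so that `(u²x, u³y) ∈ ℤ × ℤ` is primitive).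
[cite: VonkanelMatschke2023, Def. 7.1 (def:ap)] -/
def uRatio (x y : ℚ) : ℚ := (uOne x y : ℚ) / (uTwo x y : ℚ)

/-- **Definition 7.1**: `(x, y) ∈ 𝒪 × 𝒪` is *almost primitive with respect to* `μ : ℤ_{≥1} → ℝ_{≥0}` if
`h(u_{x,y}) ≤ μ(a_S)`. ("`(x,y) ∈ ℤ × ℤ` is primitive iff it is almost primitive with respect to all `μ`.")
[cite: VonkanelMatschke2023, Def. 7.1 (def:ap)] -/
def IsAlmostPrimitive (μ : ℕ → ℝ) (S : Finset ℕ) (a x y : ℚ) : Prop :=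
  logHeight₁ (uRatio x y) ≤ μ (mordellLevel S a)

/-- `α_S = a_S / N_S = 1728 N_S r₂(a)` (§7.1). [cite: VonkanelMatschke2023, §7.1 (α_S)] -/
def alphaLevel (S : Finset ℕ) (a : ℚ) : ℕ := 1728 * primesProd S * coprimePartTrunc S a

/-- `|f|` for Coates' `f` = the largest divisor of `a ∈ ℤ` which is only divisible by primes in `S` (§7.1):
`∏_{p ∈ S} p^{ord_p(a)}`. [cite: VonkanelMatschke2023, §7.1 (f)] -/
def sPart (S : Finset ℕ) (a : ℤ) : ℕ := ∏ p ∈ S, p ^ padicValNat p a.natAbs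

/-! ### Theorem G, Corollary H, Theorem 7.2 (`thm:m`) -/

/-- **Theorem G** (§1.2.1; = Theorem 7.2 (i) with `μ = 0`): *"Let `a ∈ ℤ` be nonzero. Assume that
`y² = x³ + a` has a solution in `ℤ × ℤ` which is primitive. Then any `(x, y) ∈ 𝒪 × 𝒪` with `y² = x³ + a`
satisfies `max(h(x), (2/3) h(y)) ≤ a_S log a_S`."* ("one can not remove the assumption":
`(3m^{3n})² = (2m^{2n})³ + m^{6n}`.) [cite: VonkanelMatschke2023, Theorem G (§1.2.1)] -/
def theoremG : Prop :=
  ∀ (S : Finset ℕ), (∀ p ∈ S, p.Prime) → ∀ a : ℤ, a ≠ 0 →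
    (∃ x₀ y₀ : ℤ, y₀ ^ 2 = x₀ ^ 3 + a ∧ IsPrimitivePair x₀ y₀) →
    ∀ x y : ℚ, IsSInteger S x → IsSInteger S y → y ^ 2 = x ^ 3 + a →
      max (logHeight₁ x) (2 / 3 * logHeight₁ y) ≤
        (mordellLevel S a : ℝ) * Real.log (mordellLevel S a)

/-- **Corollary H** (§1.2.1), with `𝓕_n` = the integers `a ≠ 0` with `rad(a) ≤ n` and `a_* = a_∅ ≤ 1728 rad(a)²`:
*"For any integer `n ≥ 1`, the set of primitive `(x, y) ∈ ℤ × ℤ` with `y² − x³ ∈ 𝓕_n` is finite and can in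
principle be determined. Furthermore if `a ∈ ℤ` satisfies `log|a| ≥ a_* log a_*`, then there are no
primitive `(x, y) ∈ ℤ × ℤ` with `y² − x³ = a`."* (Both sentences; "can in principle be determined" is not
expressible and is dropped.) [cite: VonkanelMatschke2023, Corollary H (§1.2.1)] -/
def corollaryH : Prop :=
  (∀ n : ℕ, 1 ≤ n →
    {xy : ℤ × ℤ | IsPrimitivePair xy.1 xy.2 ∧ xy.2 ^ 2 - xy.1 ^ 3 ≠ 0 ∧
      UniqueFactorizationMonoid.radical (xy.2 ^ 2 - xy.1 ^ 3).natAbs ≤ n}.Finite) ∧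
  (∀ a : ℤ, a ≠ 0 →
    (mordellLevel ∅ a : ℝ) * Real.log (mordellLevel ∅ a) ≤ Real.log |(a : ℝ)| →
      ∀ x y : ℤ, IsPrimitivePair x y → y ^ 2 ≠ x ^ 3 + a)

/-- **Theorem 7.2 (i)** (`thm:m`): *"Let `μ : ℤ_{≥1} → ℝ_{≥0}` be an arbitrary function. Assume that (1.2) has a
solution which is almost primitive with respect to `μ`. Then any solution `(x, y)` of (1.2) satisfies
`max(h(x), (2/3)h(y)) ≤ (2/3) a_S log a_S + (1/4) a_S log log log a_S + (3/5) a_S + 2μ(a_S)`. Moreover, if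
`(x, y)` is in addition almost primitive with respect to `μ` then
`max(h(x), (2/3)h(y)) ≤ (2/9) a_S log a_S + (1/12) a_S log log log a_S + (1/4) a_S + 2μ(a_S)`."*
(`a_S ≥ 1728`, so the triple logarithm is real.) [cite: VonkanelMatschke2023, Thm. 7.2 (i) (arXiv §7, thm:m)] -/
def theorem_7_2_i : Prop :=
  ∀ (μ : ℕ → ℝ), (∀ n, 0 ≤ μ n) → ∀ (S : Finset ℕ), (∀ p ∈ S, p.Prime) → ∀ a : ℚ, a ≠ 0 → IsSInteger S a →
    (∃ x₀ y₀ : ℚ, IsSInteger S x₀ ∧ IsSInteger S y₀ ∧ y₀ ^ 2 = x₀ ^ 3 + a ∧ IsAlmostPrimitive μ S a x₀ y₀) →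
    ∀ x y : ℚ, IsSInteger S x → IsSInteger S y → y ^ 2 = x ^ 3 + a →
      max (logHeight₁ x) (2 / 3 * logHeight₁ y) ≤
          2 / 3 * (mordellLevel S a : ℝ) * Real.log (mordellLevel S a) +
            1 / 4 * (mordellLevel S a : ℝ) * Real.log (Real.log (Real.log (mordellLevel S a))) +
            3 / 5 * (mordellLevel S a : ℝ) + 2 * μ (mordellLevel S a) ∧
      (IsAlmostPrimitive μ S a x y →
        max (logHeight₁ x) (2 / 3 * logHeight₁ y) ≤
          2 / 9 * (mordellLevel S a : ℝ) * Real.log (mordellLevel S a) +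
            1 / 12 * (mordellLevel S a : ℝ) * Real.log (Real.log (Real.log (mordellLevel S a))) +
            1 / 4 * (mordellLevel S a : ℝ) + 2 * μ (mordellLevel S a))

/-- **Theorem 7.2 (ii)** (`thm:m`): *"Suppose that `a ∈ ℤ` with `|a| → ∞` and define
`a_* = 1728 ∏_{p∣a} p^{min(2, ord_p(a))}`. Then any primitive solution `(x, y) ∈ ℤ × ℤ` of the Mordell
equation satisfies `max(h(x), (2/3)h(y)) ≤ (1/6) a_* log a_* + ((2/9) log 2 + o(1))/(log log a_*) · a_* log a_*`."*
Rendered: for every `δ > 0` there is `A₀` such that the bound with `o(1)` replaced by `δ` holds whenever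
`|a| ≥ A₀`. [cite: VonkanelMatschke2023, Thm. 7.2 (ii) (arXiv §7, thm:m)] -/
def theorem_7_2_ii : Prop :=
  ∀ δ : ℝ, 0 < δ → ∃ A₀ : ℝ, ∀ a : ℤ, A₀ ≤ |(a : ℝ)| →
    ∀ x y : ℤ, IsPrimitivePair x y → y ^ 2 = x ^ 3 + a →
      max (logHeight₁ (x : ℚ)) (2 / 3 * logHeight₁ (y : ℚ)) ≤
        1 / 6 * (mordellLevel ∅ a : ℝ) * Real.log (mordellLevel ∅ a) +
          (2 / 9 * Real.log 2 + δ) / Real.log (Real.log (mordellLevel ∅ a)) *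
            ((mordellLevel ∅ a : ℝ) * Real.log (mordellLevel ∅ a))

/-! ### The difference of perfect squares and perfect cubes (§7.1: Corollaries 7.3, 7.4, I) -/

/-- **Corollary 7.3** (`cor:coates1`; `a ∈ ℤ ∖ {0}`, `f` the largest divisor of `a` composed of primes in `S`,
`α_S = a_S/N_S = 1728 N_S r₂(a)`): *"If `(x, y) ∈ ℤ × ℤ` with `y² − x³ = a` and `gcd(x, y, N_S) = 1`, then
`log max(|x|,|y|) ≤ ½ log|a/f| + 2 α_S log α_S + ¾ α_S log log log α_S + 6 α_S`."* (It "improves Coates'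
result" (7.x) `eq:coates`.) [cite: VonkanelMatschke2023, Cor. 7.3 (arXiv §7.1, cor:coates1)] -/
def corollary_7_3 : Prop :=
  ∀ (S : Finset ℕ), (∀ p ∈ S, p.Prime) → ∀ a : ℤ, a ≠ 0 → ∀ x y : ℤ, y ^ 2 - x ^ 3 = a →
    Int.gcd (Int.gcd x y : ℤ) (primesProd S) = 1 →
      Real.log ((max |x| |y| : ℤ) : ℝ) ≤
        1 / 2 * Real.log ((a.natAbs : ℝ) / sPart S a) +
          2 * (alphaLevel S a : ℝ) * Real.log (alphaLevel S a) +
          3 / 4 * (alphaLevel S a : ℝ) * Real.log (Real.log (Real.log (alphaLevel S a))) +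
          6 * (alphaLevel S a : ℝ)

/-- **Corollary 7.4** (`cor:coates2`): *"For any real number `ε > 0` there is an effective constant `c(ε)`,
depending only on `ε`, with the following property: Suppose that `x` and `y` are coprime rational integers,
and write `X = max(|x|,|y|)`. Then the greatest rational prime factor of `y² − x³` exceeds
`(1 − ε) log log X + c(ε)`."* ("improves the old theorem of Coates", lower bound `10⁻³(log log X)^{1/4}`, and
the factor `1/84 − ε` of Bugeaud.) Effectivity of `c(ε)` is dropped; the greatest prime factor is
`(y² − x³).natAbs.primeFactors.sup id` (`0` if `y² = x³`, where for coprime `x, y` one has `X = 1` and the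
printed bound is vacuous). [cite: VonkanelMatschke2023, Cor. 7.4 (arXiv §7.1, cor:coates2)] -/
def corollary_7_4 : Prop :=
  ∀ ε : ℝ, 0 < ε → ∃ c : ℝ, ∀ x y : ℤ, IsCoprime x y →
    (1 - ε) * Real.log (Real.log ((max |x| |y| : ℤ) : ℝ)) + c <
      (((y ^ 2 - x ^ 3).natAbs.primeFactors.sup id : ℕ) : ℝ)

/-- **Corollary I** (§1.2.1; Corollary 7.4 with `ε = 1/10`: "one can take here the constant `c(ε) = −20`"):
*"Suppose that `x, y ∈ ℤ` are coprime, and write `X = max(|x|,|y|)`. Then the greatest rational prime divisor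
`p` of `y² − x³` exceeds `(1 − 1/10) log log X − 20`."* [cite: VonkanelMatschke2023, Corollary I (§1.2.1) and Cor. 7.4] -/
def corollaryI : Prop :=
  ∀ x y : ℤ, IsCoprime x y →
    (1 - 1 / 10) * Real.log (Real.log ((max |x| |y| : ℤ) : ℝ)) - 20 <
      (((y ^ 2 - x ^ 3).natAbs.primeFactors.sup id : ℕ) : ℝ)

/-! ### Cubic Thue and Thue–Mahler equations (§1.2.2, Corollary J) -/

/-- The binary cubic form `f(x, y) = a x³ + b x² y + c x y² + d y³` attached to a Mathlib `Cubic`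
`⟨a, b, c, d⟩`; its discriminant `Δ` is `Cubic.discr`. [cite: VonkanelMatschke2023, §1 (eq:thue)] -/
def cubicFormEval (P : Cubic ℚ) (x y : ℚ) : ℚ :=
  P.a * x ^ 3 + P.b * x ^ 2 * y + P.c * x * y ^ 2 + P.d * y ^ 3

/-- `f ∈ 𝒪[x, y]` and `m ∈ 𝒪`: all coefficients of `f` and `m` lie in `ℤ[1/N_S]` (with `S = ∅`: `f, m`
integral, "`f, m ∈ ℤ[x, y]`"). [cite: VonkanelMatschke2023, §1 (eq:thue)] -/
def IsSIntegralData (S : Finset ℕ) (P : Cubic ℚ) (m : ℚ) : Prop :=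
  IsSInteger S P.a ∧ IsSInteger S P.b ∧ IsSInteger S P.c ∧ IsSInteger S P.d ∧ IsSInteger S m

/-- "`f, m ∈ ℤ[x, y]`" (Corollary J (i): the case `n = 2`): all coefficients of `f` and `m` are rational
integers, i.e. have denominator `1` (equivalently `IsSIntegralData ∅`). An `abbrev` so that the case
distinction `n = 2 / n = 10` is decidable. [cite: VonkanelMatschke2023, Corollary J (i) (§1.2.2)] -/
abbrev IsIntegralData (P : Cubic ℚ) (m : ℚ) : Prop :=
  P.a.den = 1 ∧ P.b.den = 1 ∧ P.c.den = 1 ∧ P.d.den = 1 ∧ m.den = 1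

/-- `h(f − m)` = the maximum of the logarithmic Weil heights of the coefficients of the polynomial
`f − m ∈ 𝒪[x, y]` (§1.2.2; `h(−m) = h(m)`). [cite: VonkanelMatschke2023, §1.2.2 (h(f−m))] -/
def coeffHeight (P : Cubic ℚ) (m : ℚ) : ℝ :=
  max (max (max (logHeight₁ P.a) (logHeight₁ P.b)) (max (logHeight₁ P.c) (logHeight₁ P.d))) (logHeight₁ m)

/-- **Corollary J** (§1.2.2; `a = 432 Δ m²`, `Δ` the discriminant of `f`; `n = 2` if `f, m ∈ ℤ[x, y]` and
`n = 10` otherwise): *"(i) Any solution `(x, y)` of the cubic Thue equation (1.3) [`f(x,y) = m`,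
`(x, y) ∈ 𝒪 × 𝒪`; `m ∈ 𝒪` nonzero, `f ∈ 𝒪[x,y]` homogeneous of degree 3 with nonzero discriminant] satisfies
`max(h(x), h(y)) ≤ a_S log a_S + 43 n h(f − m)`. (ii) If `(x, y, z)` is a solution of the cubic Thue–Mahler
equation (1.4) [`f(x, y) = m z` with `x, y, z ∈ ℤ`, `z ∈ 𝒪^×`, `gcd(x, y) = 1`] then
`max(h(x), h(y), (1/3) h(z)) ≤ 2 a_S log a_S + 86 n h(f − m)`."* A refinement, Corollary 8.2
(`cor:precthue`, with `Ω_opt`), is not typed. [cite: VonkanelMatschke2023, Corollary J (§1.2.2)] -/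
def corollaryJ : Prop :=
  ∀ (S : Finset ℕ), (∀ p ∈ S, p.Prime) → ∀ (P : Cubic ℚ) (m : ℚ), IsSIntegralData S P m → m ≠ 0 →
    P.discr ≠ 0 →
    let a : ℚ := 432 * P.discr * m ^ 2
    let n : ℝ := if IsIntegralData P m then 2 else 10
    (∀ x y : ℚ, IsSInteger S x → IsSInteger S y → cubicFormEval P x y = m →
        max (logHeight₁ x) (logHeight₁ y) ≤
          (mordellLevel S a : ℝ) * Real.log (mordellLevel S a) + 43 * n * coeffHeight P m) ∧
    (∀ x y z : ℤ, IsSUnit S (z : ℚ) → Int.gcd x y = 1 → cubicFormEval P x y = m * z →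
        max (max (logHeight₁ (x : ℚ)) (logHeight₁ (y : ℚ))) (1 / 3 * logHeight₁ (z : ℚ)) ≤
          2 * (mordellLevel S a : ℝ) * Real.log (mordellLevel S a) + 86 * n * coeffHeight P m)

/-! ### Generalized Ramanujan–Nagell equations and sums of units (§1.2.3, §9) -/

/-- **Corollary K** (§1.2.3; `b, c ∈ 𝒪` nonzero, `a = b c²`): *"If `(x, y)` satisfies the generalized
Ramanujan–Nagell equation (1.5) [`x² + b = c y`, `(x, y) ∈ 𝒪 × 𝒪^×`], then
`max(2h(x), h(y)) ≤ 2 a_S + h(a) + 3 h(c)`."* [cite: VonkanelMatschke2023, Corollary K (§1.2.3)] -/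
def corollaryK : Prop :=
  ∀ (S : Finset ℕ), (∀ p ∈ S, p.Prime) → ∀ b c : ℚ, b ≠ 0 → c ≠ 0 → IsSInteger S b → IsSInteger S c →
    ∀ x y : ℚ, IsSInteger S x → IsSUnit S y → x ^ 2 + b = c * y →
      max (2 * logHeight₁ x) (logHeight₁ y) ≤
        2 * (mordellLevel S (b * c ^ 2) : ℝ) + logHeight₁ (b * c ^ 2) + 3 * logHeight₁ c

/-- **Corollary 9.1** (`cor:ranabounds`), recorded with `Ω_sim` (Prop. 10.1) in place of the optimized
`Ω_opt` (Prop. 10.7): printed is *"If `(x, y)` satisfies (1.5) then `h(x²), h(y) ≤ 3 Ω_opt + 3 h(c) + 8 log N_S`"*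
together with "`Ω_opt ≤ Ω_sim`" (§9), `Ω_• = Ω_•(a, S)`, `a = b c²`; the statement below (with `Ω_sim`) is the
WEAKER consequence of the two printed assertions. [cite: VonkanelMatschke2023, Cor. 9.1 (arXiv §9, cor:ranabounds) with Ω_opt ≤ Ω_sim] -/
def corollary_9_1_sim : Prop :=
  ∀ (S : Finset ℕ), (∀ p ∈ S, p.Prime) → ∀ b c : ℚ, b ≠ 0 → c ≠ 0 → IsSInteger S b → IsSInteger S c →
    ∀ x y : ℚ, IsSInteger S x → IsSUnit S y → x ^ 2 + b = c * y →
      max (logHeight₁ (x ^ 2)) (logHeight₁ y) ≤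
        3 * omegaSim S (b * c ^ 2) + 3 * logHeight₁ c + 8 * Real.log (primesProd S)

/-- **Corollary 9.3** (`cor:sumsofunits`), recorded with `Ω' = 3 Ω_sim(1, S) + 9 log N_S` in place of the
printed `Ω = 3 Ω_opt(1, S) + 9 log N_S` (WEAKER consequence, via the printed `Ω_opt ≤ Ω_sim`): *"Assume that
`u, v` are in `𝒪^×`. (i) If `u + v` is a square in `ℚ`, then there is `ε ∈ 𝒪^×` such that
`h(ε²u), h(ε²v) ≤ Ω`. (ii) If `u + v` is a cube in `ℚ`, then there is `δ ∈ 𝒪^×` such that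
`h(δ³u), h(δ³v) ≤ Ω`."* [cite: VonkanelMatschke2023, Cor. 9.3 (arXiv §9, cor:sumsofunits) with Ω_opt ≤ Ω_sim] -/
def corollary_9_3_sim : Prop :=
  ∀ (S : Finset ℕ), (∀ p ∈ S, p.Prime) → ∀ u v : ℚ, IsSUnit S u → IsSUnit S v →
    (IsSquare (u + v) → ∃ ε : ℚ, IsSUnit S ε ∧
        max (logHeight₁ (ε ^ 2 * u)) (logHeight₁ (ε ^ 2 * v)) ≤
          3 * omegaSim S 1 + 9 * Real.log (primesProd S)) ∧
    ((∃ w : ℚ, u + v = w ^ 3) → ∃ δ : ℚ, IsSUnit S δ ∧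
        max (logHeight₁ (δ ^ 3 * u)) (logHeight₁ (δ ^ 3 * v)) ≤
          3 * omegaSim S 1 + 9 * Real.log (primesProd S))

/-- RETIRED — MIS-FORMALISED, FALSE AS STATED (referee abc-stewartyu-ref g18, 2026-08-26; kernel refutation
`not_corollaryL` below): in this first rendering of Corollary L the casts `(UniqueFactorizationMonoid.radical … : ℝ)`
elaborate the radical `r = rad(mn)` IN THE FIELD `ℝ`, where it is identically `1`; the threshold `(90r)² log(9r)`
degenerates to the constant `8100 log 9` and the statement fails (e.g. `m = 1`, `n = 9^8102 − 1`, `m + n` a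
square). Kept byte-identical (landed names are not edited in place); SUPERSEDED by `corollary_L` below, which
computes `rad(mn)` in `ℕ`. Do not use this name. [cite: VonkanelMatschke2023, Corollary L (§1.2.3) — retired rendering] -/
def corollaryL : Prop :=
  ∀ m n : ℤ, IsCoprime m n →
    ((90 * (UniqueFactorizationMonoid.radical (m * n).natAbs : ℝ)) ^ 2 *
          Real.log (9 * (UniqueFactorizationMonoid.radical (m * n).natAbs : ℝ)) < Real.log |(m : ℝ)| ∨
      (90 * (UniqueFactorizationMonoid.radical (m * n).natAbs : ℝ)) ^ 2 *
          Real.log (9 * (UniqueFactorizationMonoid.radical (m * n).natAbs : ℝ)) < Real.log |(n : ℝ)|) →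
    ¬ IsSquare (m + n) ∧ ¬ ∃ k : ℤ, m + n = k ^ 3

/-- Kernel refutation of the retired rendering `corollaryL` (referee g18, `refg18_probe_b.lean`): with the radical
evaluated in the field `ℝ` the hypothesis reads `8100 · log 9 < log |n|`, satisfied by `m = 1`,
`n = 9^{2·4051} − 1`, although `m + n = (9^{4051})²` is a square. [cite: VonkanelMatschke2023, Corollary L (§1.2.3) — retired rendering] -/
theorem not_corollaryL : ¬ corollaryL := by
  intro h
  have hrad : ∀ z : ℤ, UniqueFactorizationMonoid.radical ((z.natAbs : ℕ) : ℝ) = 1 := fun z => by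
    by_cases h0 : ((z.natAbs : ℕ) : ℝ) = 0
    · rw [h0, UniqueFactorizationMonoid.radical_zero]
    · exact UniqueFactorizationMonoid.radical_of_isUnit (isUnit_iff_ne_zero.mpr h0)
  have key : ∀ N : ℕ, 4051 ≤ N →
      (90 * (1 : ℝ)) ^ 2 * Real.log (9 * 1) < Real.log |(((9 : ℤ) ^ (2 * N) - 1 : ℤ) : ℝ)| := by
    intro N hN
    have h9 : (1 : ℝ) < 9 := by norm_num
    have hlog9 : 0 < Real.log 9 := Real.log_pos h9
    have hpow : (9 : ℝ) ≤ 9 ^ (2 * N) := by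
      calc (9 : ℝ) = 9 ^ 1 := (pow_one _).symm
        _ ≤ 9 ^ (2 * N) := pow_le_pow_right₀ h9.le (by omega)
    have hcast : (((9 : ℤ) ^ (2 * N) - 1 : ℤ) : ℝ) = 9 ^ (2 * N) - 1 := by push_cast; ring
    rw [hcast, abs_of_pos (by linarith)]
    have hlow : (9 : ℝ) ^ (2 * N) / 9 ≤ 9 ^ (2 * N) - 1 := by
      rw [div_le_iff₀ (by norm_num : (0 : ℝ) < 9)]; nlinarith
    have hlog_low : Real.log (9 ^ (2 * N) / 9) ≤ Real.log (9 ^ (2 * N) - 1) :=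
      Real.log_le_log (by positivity) hlow
    have hval : Real.log ((9 : ℝ) ^ (2 * N) / 9) = (2 * N - 1 : ℝ) * Real.log 9 := by
      rw [Real.log_div (by positivity) (by norm_num), Real.log_pow]; push_cast; ring
    have hN' : (8100 : ℝ) < 2 * N - 1 := by
      have : (4051 : ℝ) ≤ N := by exact_mod_cast hN
      linarith
    calc (90 * (1 : ℝ)) ^ 2 * Real.log (9 * 1) = 8100 * Real.log 9 := by norm_num
      _ < (2 * N - 1 : ℝ) * Real.log 9 := mul_lt_mul_of_pos_right hN' hlog9
      _ = Real.log (9 ^ (2 * N) / 9) := hval.symm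
      _ ≤ Real.log (9 ^ (2 * N) - 1) := hlog_low
  have hcop : IsCoprime (1 : ℤ) ((9 : ℤ) ^ (2 * 4051) - 1) := isCoprime_one_left
  have hsqN : ∀ N : ℕ, IsSquare ((1 : ℤ) + ((9 : ℤ) ^ (2 * N) - 1)) := fun N => ⟨9 ^ N, by ring⟩
  have hsq := hsqN 4051
  have hmain := h 1 ((9 : ℤ) ^ (2 * 4051) - 1) hcop
  simp only [one_mul, hrad] at hmain
  exact (hmain (Or.inr (key 4051 le_rfl))).1 hsq

/-- **Corollary L** (§1.2.3; `r = rad(mn)`, condition `(*)`: "the natural logarithm of `|m|` or `|n|` exceeds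
`(90r)² log(9r)`"; SUPERSEDES the retired `corollaryL`): *"Suppose that `m` and `n` are arbitrary coprime rational
integers. If condition `(*)` holds, then `m + n` is not a perfect square or cube."* Here `r = rad(mn)` is the
radical of `|mn|` computed in `ℕ` and then cast to `ℝ` (`((… : ℕ) : ℝ)`). (Proved in §9 from (9.x)
`claimsquare`/`claimcube` with `S = {p ∣ mn}`, `N_S = rad(mn)`.) [cite: VonkanelMatschke2023, Corollary L (§1.2.3; proof in §9)] -/
def corollary_L : Prop :=
  ∀ m n : ℤ, IsCoprime m n →
    ((90 * ((UniqueFactorizationMonoid.radical (m * n).natAbs : ℕ) : ℝ)) ^ 2 *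
          Real.log (9 * ((UniqueFactorizationMonoid.radical (m * n).natAbs : ℕ) : ℝ)) < Real.log |(m : ℝ)| ∨
      (90 * ((UniqueFactorizationMonoid.radical (m * n).natAbs : ℕ) : ℝ)) ^ 2 *
          Real.log (9 * ((UniqueFactorizationMonoid.radical (m * n).natAbs : ℕ) : ℝ)) < Real.log |(n : ℝ)|) →
    ¬ IsSquare (m + n) ∧ ¬ ∃ k : ℤ, m + n = k ^ 3

/-! ### API -/

/-- Coprime integers are primitive (§1.2.1: "In particular `(x, y) ∈ ℤ × ℤ` is primitive if `x, y` are
coprime"), PROVED: if `n⁶ ∣ x³` and `n⁶ ∣ y²` with `x, y` coprime then `n` is a unit.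
[cite: VonkanelMatschke2023, §1.2.1 (coprime ⇒ primitive)] -/
theorem IsPrimitivePair.of_isCoprime {x y : ℤ} (h : IsCoprime x y) : IsPrimitivePair x y := by
  intro n h3 h2
  have hu : IsUnit (n ^ 6) :=
    (IsCoprime.pow h (m := 3) (n := 2)).isUnit_of_dvd' h3 h2
  exact Int.isUnit_iff.mp (isUnit_pow_iff (by norm_num) |>.mp hu)

/-- For integers the scaling factor `u₁` of Definition 7.1 is `1`. [cite: VonkanelMatschke2023, Def. 7.1] -/
theorem uOne_intCast (x y : ℤ) : uOne (x : ℚ) (y : ℚ) = 1 := by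
  simp [uOne]

/-- Unfolding lemma for `α_S`: `α_S · N_S = a_S`. [cite: VonkanelMatschke2023, §7.1 (α_S = a_S/N_S)] -/
theorem alphaLevel_mul_primesProd (S : Finset ℕ) (a : ℚ) :
    alphaLevel S a * primesProd S = mordellLevel S a := by
  rw [alphaLevel, mordellLevel_def, coprimePartTrunc]; ring

end VonKanelMatschke

end Literature.NumberTheory.DiophantineGeometry

end
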